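import Summits.QuantumFields.BalabanUV.T4Continuum.Spine.NE1p.DressedSmallFieldMixedDerivativeBridge

/-!
# T⁴ programme, spine estimate NE1′ (node O3b/H2) — THE SUBSTRATE's CONTOUR LETTERS ARE DIMOCK's `∂∕∂s_{Z−Y}`, part 2 (THE INNER CONTOURS
# ARE THE MIXED DECOUPLING DERIVATIVE): at a FIXED interpolation point `s ∈ [0,1]^S` — before the `s`-integrations — the `σ(Δ)`-contours of
# W39.1's `n`-cube letter reproduce `∂_{enumS S} F (basePt S s)` = Dimock's `∂∕∂s_S F` at `(s on S, 0 off S)` for a JOINTLY ANALYTIC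
# table-free factor ((1.23)∕(2.14)'s Cauchy representation POINTWISE in `s`, all active cubes at once), at print's weight-letter cost
# `Π_{Δ∈S} r_Δ∕(r_Δ−1)²·B` — `e^{−(κ₁−1)·#S}·B` at the (1.22)-radius

Cell `pub-balaban`, sub-cell `t4`, row NE1′ formalisation crew (`t4/formal/NE1p/LEAVES.md` row W55 ∕ DAG N29zzza as pre-assigned by typer R-T129 —
own-initiative witness under R-T61 (ii); INTENT journal HOME/CLAIMS.log l.20319, AMENDMENT l.20343; (D1) TWO PARTS, part 1 =
`DressedSmallFieldMixedDerivativeBridge`), unit `b2b-balaban-t4-ne1p-formalise-leaf-08` (gen 11).  ADDITIVE — imports part 1 ONLY (through it W39.1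
`DressedSmallFieldMixedLetter`: `cw`, `wS`, `σc`, `σS`, `wS_cons`, `σS_cons`, `measurable_wS`, `measurable_σS`, `measurable_cw`, `norm_σS_le`,
`norm_wS_le`, `norm_cw_le`, `wS_univ`, `σS_univ` BY NAME; W34 `one_lt_rexp`∕`decouplingFactor_pow_le`; the NE5 substrate `Support/B13TermContours`:
`w₁`, `wB₁`, `circ`, `wJ`, `sigmaJ`, `norm_w₁_le`, `measurable_w₁`, **`setIntegral_w₁_mul_eq_deriv`** BY NAME; Dimock's `mixedDeriv` BY NAME).
TWO dictionary DATA `def`s (`θS`, `pairθ`), one finiteness `instance`, theorems, 3 `example`s (2 decided checks + Lemma 19 BY NAME); 0 `def … : Prop`,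
0 cite, 0 sorry, 0 `attribute`; nothing of part 1 ∕ W39.1 ∕ W34 ∕ the substrate ∕ the Literature module (`lemma19_cauchy`, `polydisc` BY NAME) restated.

WHY THIS FILE.  [Balaban1988RGII] p. 7 (1.23) «Π_{Δ⊂Y₀∖□̃⁴} ∫ ds(Δ) (1∕2πi) ∫ dσ(Δ)∕(σ(Δ) − s(Δ))² · E(…)», «we represent all derivatives
by the Cauchy formula», «the σ(Δ)-integrations are over the circles |σ(Δ)| = e^{κ₁}», (1.24) «|(1.23)| ≤ … · exp(−(κ₁ − 1)M⁻⁴|Y₀∖□̃⁴|) …»;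
p. 15 (2.14)∕(2.15) «exp(−(κ₁ − 1)(LM)⁻⁴|Z∖Z′₀|)» — LOCI of the audited manuscript, TYPE∕CONTEXT only.  The substrate checked ONE cube
(`setIntegral_w₁_mul_eq_deriv`: the `θ`-integral at fixed `t ∈ [0,1]` is `F′(t)`; W34 `cubeLetter_inner_eq_deriv`) and W39.1 the `ds dθ`-integrated
`n`-cube letter (= the mixed DIFFERENCE `Δ_S F`).  Here the `n`-cube statement POINTWISE IN `s`, landing on Dimock's kernel derivative:
* §2 the angular coordinate measures `θS S` (`dθ|[0,2π]` on an active cube, a Dirac filler else — the `θ`-marginal of W39.1's `μS`), the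
  configuration `pairθ s θ = (s_j, θ_j)_j` fed to W39.1's OWN `wS`∕`σS` (the SAME integrand as `mixedLetter_rep`, sectioned at `s`);
  **`mixedDerivLetter_rep`: for radii `> 1`, `F` JOINTLY analytic on `ℂⁿ` and `s_j ∈ [0,1]` on the active cubes,
  `∫ wS r S (s,θ)·F(σ_S(s,θ)) d(⨂_j θS S j)(θ) = mixedDeriv (enumS S) F (basePt S s)`** — induction along `Fin.cons` (Mathlib
  `measurePreserving_piFinSuccAbove`, Fubini), the substrate's `setIntegral_w₁_mul_eq_deriv` ONCE BY NAME on the outer active cube applied to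
  part 1's ENTIRE head section, `integral_dirac` on an inactive cube; **`mixedDerivLetter_majorant_le`** (`∫‖…‖ ≤ (Π_{j∈S} r_j∕(r_j−1)²)·B` —
  the substrate's `norm_w₁_le` per active cube, `|[0,2π]| = 2π`) and the corollaries `norm_mixedDeriv_enumS_le_letter` ∕ `_decay_letter`
  (`≤ e^{−(κ₁−1)·#S}·B` at radii `e^{κ₁}`, W34 `decouplingFactor_pow_le`): the COST OF THE CONTOUR REPRESENTATION under a bound on the contour
  configurations only — print's (2.15) weight-letter shape; for the derivative itself Dimock's `lemma19_cauchy` (bound on the polydisc,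
  `1∕(R−1)` per cube) is sharper and is NOT re-derived.
* §3 at `S = univ` the weight∕contour ARE the substrate's `wJ`∕`sigmaJ` (`mixedDerivLetter_rep_univ`); two DECIDED checks on the product factor
  `z₀z₁` (the letter at ANY `s ∈ [0,1]²` and radii is `∂₀∂₁(z₀z₁) = 1`; the letter bound reads `1 ≤ e^{−2(κ₁−1)}·e^{2κ₁}`); and THE BRIDGE's
  PAYOFF as a statement-level `example`: Dimock's `lemma19_cauchy` applies VERBATIM, BY NAME, to the letter's object `mixedDeriv (enumS S) F (basePt S s)`.

HONEST FRAMING.  TYPER CONDITIONS (R-T128 (α)–(γ), R-T129 (δ)): (α) the located object is NEW — the `θ`-SECTION END (derivative, pointwise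
in `s`), a sibling of W39.1's `mixedLetter_rep` (difference, `ds dθ`), not a second applier of it, and distinct from W39.2∕W43 (which APPLY the
difference letter); (β) «pointwise in s» is the kernel statement `∀ s, (∀ j ∈ S, s j ∈ Icc 0 1) → …` at `s`-uniform radii, the joint analyticity
ENTERS AS THE HYPOTHESIS `AnalyticOnNhd ℂ F univ` (print's word «analytic») and propagates to `∂^{S′}` by Dimock's `analyticOnNhd_mixedDeriv` BY
NAME (part 1); (γ) definition lane, no slot, cap 400; (δ) distinct from W54 (operator-datum letters on S42's cores) — no core, no operator, no
N0·∕S42 END here.  [folklore] analysis (Fubini on `Measure.pi` along `Fin.cons`, Cauchy's formula for a first derivative through the substrate's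
checked ONE-variable dictionary, compactness) + located real arithmetic on the substrate's CONTOUR OBJECTS; a DICTIONARY∕BRIDGE, not an estimate
of print: `θS`∕`pairθ` (and part 1's `enumS`∕`basePt`) are OURS; `F` ↔ print's s(Δ)-dependent operator products and the radii ↔ (1.22)'s
circle are TYPE READINGS; `‖F∘σS‖ ≤ B` is a HYPOTHESIS (print's (1.18)∕(1.21) TYPE); the hypothesis is JOINT analyticity on ALL of `ℂⁿ` —
print's TYPE is a neighbourhood of the closed polydisc, whose LOCAL version is the natural follower (as W43 was for W39.1), NOT claimed;
`κ₁ ≥ 1` is OUR threshold on OUR majorant shape — no numeral of [Balaban1988RGII] asserted (k2); (B1) for Bałaban's (2.14) NOT discharged; (B3) = GAPS G-ne9p2-5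
UNPRINTED — NOT discharged, untouched; (B5) untouched; 0 binders instantiated on Bałaban's densities ∕ operators ∕ (2.14) data ∕ `d_k` ∕
minimisers ∕ backgrounds; discharges no wall item; wall v1.7 (T4-DAG v46) does NOT move; R-t4r2-Q2 NOT met thereby; NE1′ ⇐ the named
binders — NOT proved, NOT printed; spine PROVED 0∕9; count 9 unchanged.  Rung (B)+1 on ONE finite four-torus — NOT infinite volume, NOT a
mass gap, NOT OS on ℝ⁴, NOT Clay.  ABSOLUTE RULE honoured: the quotations are LOCI of the audited manuscript [Balaban1988RGII] (CMP 116 (1988) 1–22, pp. 7, 15),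
TYPE∕CONTEXT only, never hypothesis-free facts; [Dimock2013] enters only through the cite-tagged Literature module BY NAME; nothing internally
minted is cited; [folklore]∕[arith] tags on kernel lemmas only.  HONEST DEPENDENCY: continuum YM on T⁴ ⇐ BetaPertH ∧ nine spine estimates (0/9 proved); BetaPertH ⇐ (D1) ∧ (D4) ∧
CAP+tail; G-an2-4 gates asym, D1 and NE2/3/4.
-/

noncomputable section

namespace Summit.QuantumFields.BalabanUV.T4Continuum.NE1p.DressedSmallFieldMixedDerivativeLetter

open MeasureTheory Metric Set Complex Finset Function
open scoped BigOperators
open Summit.QuantumFields.BalabanUV.T4Continuum.B13TermContours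
open Summit.QuantumFields.BalabanUV.T4Continuum.NE1p.DressedSmallFieldCubeLetterWitness (one_lt_rexp decouplingFactor_pow_le)
open Summit.QuantumFields.BalabanUV.T4Continuum.NE1p.DressedSmallFieldMixedLetter
open Summit.QuantumFields.BalabanUV.T4Continuum.NE1p.DressedSmallFieldMixedDerivativeBridge
open Literature.MathematicalPhysics.QuantumFieldTheory.Dimock2011to13.PolydiscCauchyBounds (mixedDeriv polydisc lemma19_cauchy)

variable {n : ℕ}

/-! ## §2 THE `θ`-SECTION OF THE `n`-CUBE LETTER: at fixed `s ∈ [0,1]^S` the contours reproduce `∂_{enumS S} F (basePt S s)` -/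

/-- THE ANGULAR MEASURE PER CUBE COORDINATE: `dθ` on `[0, 2π]` on an active cube, a Dirac filler on an inactive one — the `θ`-marginal
of W39.1's `μS` (whose active coordinates carry `lam₁ = ds|[0,1] ⊗ dθ|[0,2π]`). -/
def θS (S : Finset (Fin n)) (j : Fin n) : Measure ℝ :=
  if j ∈ S then volume.restrict (Icc (0 : ℝ) (2 * Real.pi)) else Measure.dirac 0

/-- [folklore] Every angular coordinate measure is finite. -/
instance isFiniteMeasure_θS (S : Finset (Fin n)) (j : Fin n) : IsFiniteMeasure (θS S j) := by
  unfold θS; split_ifs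
  · exact isFiniteMeasure_restrict.2 measure_Icc_lt_top.ne
  · infer_instance

/-- [folklore] Tail of the angular measures along `Fin.succ`. -/
theorem θS_succ (S : Finset (Fin (n + 1))) (j : Fin n) : θS S j.succ = θS (tailSet S) j := by
  simp only [θS, mem_tailSet]

/-- The parameter configuration at FIXED interpolation point `s` and angles `θ`: `p_j = (s_j, θ_j)` — fed to W39.1's weight `wS` and
contour configuration `σS` (the SAME integrand as `mixedLetter_rep`, sectioned at `s`). -/
def pairθ (s θ : Fin n → ℝ) : Fin n → ℝ × ℝ := fun j => (s j, θ j)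

/-- [folklore] The configuration along `Fin.cons`. -/
theorem pairθ_cons (s : Fin (n + 1) → ℝ) (x : ℝ) (z : Fin n → ℝ) :
    pairθ s (Fin.cons x z) = Fin.cons (s 0, x) (pairθ (Fin.tail s) z) := by
  funext j
  induction j using Fin.cases with
  | zero => simp [pairθ]
  | succ i => simp [pairθ, Fin.tail]

/-- [folklore] The configuration is measurable in the angles. -/
theorem measurable_pairθ (s : Fin n → ℝ) : Measurable (pairθ s) :=
  measurable_pi_lambda _ fun j => measurable_const.prodMk (measurable_pi_apply j)

/-- **THE INNER CONTOURS ARE THE MIXED DECOUPLING DERIVATIVE** (kernel; induction along `Fin.cons`: Mathlib's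
`measurePreserving_piFinSuccAbove` + Fubini on the angular torus, the substrate's ONE-variable `setIntegral_w₁_mul_eq_deriv` BY NAME on
the outer cube applied to the head section `z ↦ ∂^{S′}(F(z ∷ ·))(s′)`, ENTIRE by Dimock's `analyticOnNhd_mixedDeriv` BY NAME (§1), a Dirac filler on an inactive cube): for radii
`r j > 1`, `F : ℂⁿ → ℂ` JOINTLY ANALYTIC (print's word; here on all of `ℂⁿ`) and an interpolation point with `s_j ∈ [0,1]` on the active
cubes, `∫ (Π_{j∈S} w₁ (r j) (s_j, θ_j))·F(σ_S(θ)) Π_{j∈S} dθ_j = ∂_{enumS S} F (basePt S s)` = Dimock's `∂∕∂s_S F` at the point `(s on S, 0 off S)` —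
(1.23)∕(2.14)'s «derivatives by the Cauchy formula … over the circles |σ(Δ)| = e^{κ₁}» for ALL active cubes at once, POINTWISE in `s`
(W39.1's `mixedLetter_rep` is its `ds`-integral). [folklore] -/
theorem mixedDerivLetter_rep : ∀ (n : ℕ) (r : Fin n → ℝ) (S : Finset (Fin n)) (F : (Fin n → ℂ) → ℂ) (s : Fin n → ℝ),
    (∀ j, 1 < r j) → AnalyticOnNhd ℂ F univ → (∀ j ∈ S, s j ∈ Icc (0 : ℝ) 1) →
    ∫ θ, wS r S (pairθ s θ) * F (σS r S (pairθ s θ)) ∂(Measure.pi (θS S)) = mixedDeriv (enumS n S) F (basePt S s)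
  | 0, r, S, F, s, _, _, _ => by
      rw [Measure.pi_of_empty (θS S), integral_dirac, mixedDeriv_enumS_zero]
      have h0 : ∀ p : Fin 0 → ℝ × ℝ, σS r S p = fun i => i.elim0 := fun p => funext fun i => i.elim0
      simp [wS, h0]
  | n + 1, r, S, F, s, hr, hF, hs => by
      have hr' : ∀ j, 1 < Fin.tail r j := fun j => hr j.succ
      have hr0 : ∀ j, 0 ≤ r j := fun j => zero_le_one.trans (hr j).le
      have hs' : ∀ j ∈ tailSet S, Fin.tail s j ∈ Icc (0 : ℝ) 1 := fun j hj => hs j.succ (mem_tailSet.1 hj)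
      have hFc : Continuous F := continuousOn_univ.1 hF.continuousOn
      set G : (Fin (n + 1) → ℝ) → ℂ := fun θ => wS r S (pairθ s θ) * F (σS r S (pairθ s θ)) with hG
      -- (i) `G` is measurable and bounded (the contour configuration stays in a compact polydisc), hence integrable
      have hGm : Measurable G := ((measurable_wS r S).comp (measurable_pairθ s)).mul
        (hFc.measurable.comp ((measurable_σS r S).comp (measurable_pairθ s)))
      obtain ⟨B, hB⟩ : ∃ B, ∀ p, ‖F (σS r S p)‖ ≤ B := by
        obtain ⟨B, hB⟩ := (isCompact_closedBall (0 : Fin (n + 1) → ℂ) (∑ j, r j)).exists_bound_of_continuousOn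
          hFc.continuousOn
        refine ⟨B, fun p => hB _ (mem_closedBall_zero_iff.2 ((pi_norm_le_iff_of_nonneg
          (Finset.sum_nonneg fun j _ => hr0 j)).2 fun j => (norm_σS_le hr0 S p j).trans
            (Finset.single_le_sum (fun j _ => hr0 j) (Finset.mem_univ j))))⟩
      have hGb : ∀ θ, ‖G θ‖ ≤ (∏ j, max (wB₁ (r j)) 1) * B := fun θ => by
        rw [hG]; dsimp only; rw [norm_mul]
        exact mul_le_mul (norm_wS_le hr S _) (hB _) (norm_nonneg _)
          (Finset.prod_nonneg fun _ _ => zero_le_one.trans (le_max_right _ _))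
      have hGi : Integrable G (Measure.pi (θS S)) :=
        Integrable.mono' (integrable_const _) hGm.aestronglyMeasurable (Filter.Eventually.of_forall hGb)
      -- (ii) Fubini along `Fin.cons`: the angle of cube `0` against the tail angles
      have hmp := (measurePreserving_piFinSuccAbove (θS S) 0).symm
      have hpi : (fun j : Fin n => θS S (Fin.succAbove 0 j)) = θS (tailSet S) := by
        funext j; rw [Fin.succAbove_zero]; exact θS_succ S j
      rw [hpi] at hmp
      have he : ∀ q : ℝ × (Fin n → ℝ),
          (MeasurableEquiv.piFinSuccAbove (fun _ : Fin (n + 1) => ℝ) 0).symm q = Fin.cons q.1 q.2 := by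
        intro q
        simp only [MeasurableEquiv.piFinSuccAbove_symm_apply, Fin.insertNthEquiv, Fin.insertNth_zero, Equiv.coe_fn_mk]
        rfl
      have h1 : ∫ θ, G θ ∂(Measure.pi (θS S)) = ∫ q, G (Fin.cons q.1 q.2) ∂((θS S 0).prod (Measure.pi (θS (tailSet S)))) := by
        rw [← hmp.integral_comp']
        exact integral_congr_ae (Filter.Eventually.of_forall fun q => by dsimp only; rw [he])
      have hint : Integrable (fun q : ℝ × (Fin n → ℝ) => G (Fin.cons q.1 q.2)) ((θS S 0).prod (Measure.pi (θS (tailSet S)))) :=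
        ((hmp.integrable_comp hGi.aestronglyMeasurable).2 hGi).congr
          (Filter.Eventually.of_forall fun q => by simp only [Function.comp_apply, he])
      have hcons : ∀ (x : ℝ) (z : Fin n → ℝ), G (Fin.cons x z) =
          cw r S 0 (s 0, x) * (wS (Fin.tail r) (tailSet S) (pairθ (Fin.tail s) z) *
            F (Fin.cons (σc r S 0 (s 0, x)) (σS (Fin.tail r) (tailSet S) (pairθ (Fin.tail s) z)))) := fun x z => by
        rw [hG]; dsimp only; rw [pairθ_cons, wS_cons, σS_cons]; ring
      -- (iii) the inner integral is the induction hypothesis on the section `σ(Δ₀) = σc r S 0 (s 0, x)`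
      have hinner : ∀ x : ℝ, ∫ z, G (Fin.cons x z) ∂(Measure.pi (θS (tailSet S))) =
          cw r S 0 (s 0, x) *
            mixedDeriv (enumS n (tailSet S)) (fun w => F (Fin.cons (σc r S 0 (s 0, x)) w)) (basePt (tailSet S) (Fin.tail s)) :=
          fun x => by
        simp_rw [hcons]
        rw [integral_const_mul, mixedDerivLetter_rep n (Fin.tail r) (tailSet S) (fun w => F (Fin.cons (σc r S 0 (s 0, x)) w))
          (Fin.tail s) hr' (analyticOnNhd_cons_section hF _) hs']
      rw [h1, integral_prod _ hint]
      dsimp only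
      simp_rw [hinner]
      -- (iv) the outer integral: the one-variable DERIVATIVE letter on an active cube, the Dirac filler on an inactive one
      by_cases h0 : (0 : Fin (n + 1)) ∈ S
      · have hμ0 : θS S 0 = volume.restrict (Icc (0 : ℝ) (2 * Real.pi)) := if_pos h0
        have hcw : ∀ x, cw r S 0 (s 0, x) = w₁ (r 0) (s 0, x) := fun x => if_pos h0
        have hσ : ∀ x : ℝ, σc r S 0 (s 0, x) = circ (r 0) x := fun x => if_pos h0
        have hH : Differentiable ℂ fun z : ℂ =>
            mixedDeriv (enumS n (tailSet S)) (fun w => F (Fin.cons z w)) (basePt (tailSet S) (Fin.tail s)) :=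
          differentiable_mixedDeriv_cons hF _ _
        have key := setIntegral_w₁_mul_eq_deriv (hr 0) isOpen_univ (Set.subset_univ _)
          (F := fun z => mixedDeriv (enumS n (tailSet S)) (fun w => F (Fin.cons z w)) (basePt (tailSet S) (Fin.tail s)))
          hH.differentiableOn (hs 0 h0).1 (hs 0 h0).2
        simp_rw [hμ0, hcw, hσ]
        rw [key, mixedDeriv_enumS_succ_of_mem h0]
      · have hμ0 : θS S 0 = Measure.dirac 0 := if_neg h0
        have hcw : ∀ x, cw r S 0 (s 0, x) = 1 := fun x => if_neg h0
        have hσ : ∀ x : ℝ, σc r S 0 (s 0, x) = 0 := fun x => if_neg h0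
        simp_rw [hμ0, hcw, hσ, one_mul]
        rw [integral_dirac, mixedDeriv_enumS_succ_of_not_mem h0]

/-- **CAUCHY's ESTIMATE FOR THE ANGULAR LETTER** (kernel; Fubini `integral_fintype_prod_eq_prod`, the substrate's `norm_w₁_le` per
active cube and `|[0,2π]| = 2π`): if the factor is bounded by `B` on the contour configurations, `∫ ‖(Π_{j∈S} w₁ (r j) (s_j,θ_j))·F(σ_S(θ))‖
Π dθ ≤ (Π_{j∈S} r_j∕(r_j − 1)²)·B` — ONE factor `r∕(r−1)²` PER ACTIVE CUBE, at every interpolation point. [folklore] -/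
theorem mixedDerivLetter_majorant_le {r : Fin n → ℝ} (hr : ∀ j, 1 < r j) (S : Finset (Fin n)) {F : (Fin n → ℂ) → ℂ} {B : ℝ}
    (s : Fin n → ℝ) (hB : ∀ p, ‖F (σS r S p)‖ ≤ B) :
    ∫ θ, ‖wS r S (pairθ s θ) * F (σS r S (pairθ s θ))‖ ∂(Measure.pi (θS S)) ≤ (∏ j ∈ S, r j / (r j - 1) ^ 2) * B := by
  have hB0 : 0 ≤ B := (norm_nonneg _).trans (hB fun _ => (0, 0))
  have hm : ∀ j, Measurable fun x : ℝ => ‖cw r S j (s j, x)‖ := fun j =>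
    ((measurable_cw r S j).comp (measurable_const.prodMk measurable_id)).norm
  have hbd : ∀ θ : Fin n → ℝ, (∏ j, ‖cw r S j (s j, θ j)‖) * B ≤ (∏ j, max (wB₁ (r j)) 1) * B := fun θ =>
    mul_le_mul_of_nonneg_right (Finset.prod_le_prod (fun _ _ => norm_nonneg _) fun j _ => norm_cw_le hr S j _) hB0
  have hi : Integrable (fun θ : Fin n → ℝ => (∏ j, ‖cw r S j (s j, θ j)‖) * B) (Measure.pi (θS S)) :=
    Integrable.mono' (integrable_const ((∏ j, max (wB₁ (r j)) 1) * B))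
      ((Finset.measurable_prod _ fun j _ => (hm j).comp (measurable_pi_apply j)).mul_const B).aestronglyMeasurable
      (Filter.Eventually.of_forall fun θ => by
        rw [Real.norm_of_nonneg (mul_nonneg (Finset.prod_nonneg fun _ _ => norm_nonneg _) hB0)]; exact hbd θ)
  calc ∫ θ, ‖wS r S (pairθ s θ) * F (σS r S (pairθ s θ))‖ ∂(Measure.pi (θS S))
      ≤ ∫ θ, (∏ j, ‖cw r S j (s j, θ j)‖) * B ∂(Measure.pi (θS S)) :=
        integral_mono_of_nonneg (Filter.Eventually.of_forall fun _ => norm_nonneg _) hi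
          (Filter.Eventually.of_forall fun θ => by
            dsimp only
            rw [norm_mul, wS, norm_prod]
            exact mul_le_mul_of_nonneg_left (hB _) (Finset.prod_nonneg fun _ _ => norm_nonneg _))
    _ = (∏ j, ∫ x, ‖cw r S j (s j, x)‖ ∂(θS S j)) * B := by
        rw [integral_mul_const, integral_fintype_prod_eq_prod (𝕜 := ℝ) (fun j x => ‖cw r S j (s j, x)‖)]
    _ ≤ (∏ j ∈ S, r j / (r j - 1) ^ 2) * B := by
        refine mul_le_mul_of_nonneg_right ?_ hB0
        have hcube : ∀ j, ∫ x, ‖cw r S j (s j, x)‖ ∂(θS S j) ≤ if j ∈ S then r j / (r j - 1) ^ 2 else 1 := by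
          intro j; unfold cw θS; split_ifs with h
          · have h2π : (0 : ℝ) ≤ 2 * Real.pi := by positivity
            calc ∫ x in Icc (0 : ℝ) (2 * Real.pi), ‖w₁ (r j) (s j, x)‖
                ≤ ∫ _ in Icc (0 : ℝ) (2 * Real.pi), wB₁ (r j) :=
                  integral_mono_of_nonneg (Filter.Eventually.of_forall fun _ => norm_nonneg _) (integrable_const _)
                    (Filter.Eventually.of_forall fun x => norm_w₁_le (hr j) _)
              _ = r j / (r j - 1) ^ 2 := by
                  rw [setIntegral_const, Real.volume_real_Icc_of_le h2π, sub_zero, smul_eq_mul, wB₁]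
                  have hr1 : (r j - 1) ^ 2 ≠ 0 := pow_ne_zero 2 (sub_ne_zero.2 (hr j).ne')
                  field_simp
          · simp
        calc ∏ j, ∫ x, ‖cw r S j (s j, x)‖ ∂(θS S j) ≤ ∏ j, (if j ∈ S then r j / (r j - 1) ^ 2 else 1) :=
              Finset.prod_le_prod (fun j _ => integral_nonneg fun _ => norm_nonneg _) fun j _ => hcube j
          _ = ∏ j ∈ S, r j / (r j - 1) ^ 2 := by rw [Finset.prod_ite_mem, Finset.univ_inter]

/-- **THE COST OF THE CONTOUR REPRESENTATION** (corollary of the two theorems above): under a bound `B` on the contour configurations only,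
`‖∂_{enumS S} F (basePt S s)‖ ≤ (Π_{j∈S} r_j∕(r_j − 1)²)·B`.  Recorded as the LETTER's cost — print's (2.15) weight-letter shape per cube; for
the derivative itself Dimock's `lemma19_cauchy` (bound on the whole polydisc, `1∕(R−1)` per cube) is sharper and is NOT re-derived here. [folklore] -/
theorem norm_mixedDeriv_enumS_le_letter {r : Fin n → ℝ} (hr : ∀ j, 1 < r j) (S : Finset (Fin n)) {F : (Fin n → ℂ) → ℂ}
    (hF : AnalyticOnNhd ℂ F univ) {B : ℝ} (hB : ∀ p, ‖F (σS r S p)‖ ≤ B) {s : Fin n → ℝ} (hs : ∀ j ∈ S, s j ∈ Icc (0 : ℝ) 1) :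
    ‖mixedDeriv (enumS n S) F (basePt S s)‖ ≤ (∏ j ∈ S, r j / (r j - 1) ^ 2) * B := by
  rw [← mixedDerivLetter_rep n r S F s hr hF hs]
  exact (norm_integral_le_integral_norm _).trans (mixedDerivLetter_majorant_le hr S s hB)

/-- **… AT THE (1.22)-RADIUS `e^{κ₁}`** (W34 `decouplingFactor_pow_le` BY NAME): for `1 ≤ κ₁` the letter's cost is `≤ e^{−(κ₁ − 1)·#S}·B` — the
shape of (1.24)'s ∕ (2.15)'s first exponential «exp(−(κ₁ − 1)·#cubes)» (TYPE), reached through the CONTOUR route. [folklore] -/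
theorem norm_mixedDeriv_enumS_decay_letter {κ₁ : ℝ} (hκ : 1 ≤ κ₁) (S : Finset (Fin n)) {F : (Fin n → ℂ) → ℂ}
    (hF : AnalyticOnNhd ℂ F univ) {B : ℝ} (hB : ∀ p, ‖F (σS (fun _ => Real.exp κ₁) S p)‖ ≤ B) {s : Fin n → ℝ}
    (hs : ∀ j ∈ S, s j ∈ Icc (0 : ℝ) 1) :
    ‖mixedDeriv (enumS n S) F (basePt S s)‖ ≤ Real.exp (-((κ₁ - 1) * S.card)) * B := by
  have hB0 : 0 ≤ B := (norm_nonneg _).trans (hB fun _ => (0, 0))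
  refine (norm_mixedDeriv_enumS_le_letter (fun _ => one_lt_rexp (by linarith)) S hF hB hs).trans ?_
  rw [Finset.prod_const]
  exact mul_le_mul_of_nonneg_right (decouplingFactor_pow_le hκ _) hB0

/-! ## §3 At `S = univ`: the substrate's `n`-variable weight `wJ` and contour `sigmaJ`, sectioned at `s`; decided checks -/

/-- [folklore] With every cube active the angular measures are `dθ|[0,2π]` on every coordinate. -/
theorem θS_univ (n : ℕ) : θS (Finset.univ : Finset (Fin n)) = fun _ => volume.restrict (Icc (0 : ℝ) (2 * Real.pi)) := by
  funext j; simp [θS]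

/-- **THE SUBSTRATE's WEIGHT AND CONTOUR, SECTIONED AT `s`, GIVE THE FULL MIXED DERIVATIVE** (§2 at `S = univ`, W39.1's `wS_univ`∕`σS_univ`):
`∫ wJ r (s,θ)·F(sigmaJ r (s,θ)) Π_j dθ_j = ∂_{enumS univ} F (s)` for `s ∈ [0,1]ⁿ` — the angular half of `Support/B13TermContours`' `lamJ`-letter
is the Cauchy representation of `∂₁⋯∂ₙ F(s)`; W39.1's `mixedLetter_rep_univ` is its `ds`-half. [folklore] -/
theorem mixedDerivLetter_rep_univ (r : Fin n → ℝ) (hr : ∀ j, 1 < r j) (F : (Fin n → ℂ) → ℂ) (hF : AnalyticOnNhd ℂ F univ)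
    (s : Fin n → ℝ) (hs : ∀ j, s j ∈ Icc (0 : ℝ) 1) :
    ∫ θ, wJ r (pairθ s θ) * F (sigmaJ r (pairθ s θ)) ∂(Measure.pi fun _ : Fin n => volume.restrict (Icc (0 : ℝ) (2 * Real.pi))) =
      mixedDeriv (enumS n Finset.univ) F (basePt Finset.univ s) := by
  rw [← θS_univ, ← wS_univ, ← σS_univ]
  exact mixedDerivLetter_rep n r _ F s hr hF fun j _ => hs j

/-- DECIDED CHECK (product factor, both cubes active): for `F(z) = z₀·z₁` the angular letter at ANY `s ∈ [0,1]²` and ANY radii `> 1` is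
`∂₀∂₁(z₀z₁) = 1` — §2's representation composed with §1's product face; the value does not depend on `s` or on the radii. -/
example (r : Fin 2 → ℝ) (hr : ∀ j, 1 < r j) (s : Fin 2 → ℝ) (hs : ∀ j, s j ∈ Icc (0 : ℝ) 1) :
    ∫ θ, wS r {0, 1} (pairθ s θ) * (σS r {0, 1} (pairθ s θ) 0 * σS r {0, 1} (pairθ s θ) 1) ∂(Measure.pi (θS {0, 1})) = 1 := by
  have hF : AnalyticOnNhd ℂ (fun z : Fin 2 → ℂ => z 0 * z 1) univ := (analyticOnNhd_apply 0).mul (analyticOnNhd_apply 1)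
  have h := mixedDerivLetter_rep 2 r {0, 1} (fun z => z 0 * z 1) s hr hF (fun j _ => hs j)
  have hp : mixedDeriv (enumS 2 {0, 1}) (fun z : Fin 2 → ℂ => z 0 * z 1) (basePt {0, 1} s) = 1 := by
    have h2 : (fun z : Fin 2 → ℂ => z 0 * z 1) = fun z => ∏ j ∈ ({0, 1} : Finset (Fin 2)), (fun _ : Fin 2 => (id : ℂ → ℂ)) j (z j) := by
      funext z; simp
    rw [h2, mixedDeriv_enumS_prod]; simp
  rw [← hp, ← h]

/-- DECIDED CHECK (the letter bound is informative): for `F(z) = z₀·z₁` on the configurations of radii `e^{κ₁}` (`‖F‖ ≤ e^{2κ₁}` there) §2's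
cost reads `1 = ‖∂₀∂₁F‖ ≤ e^{−2(κ₁−1)}·e^{2κ₁} = e²` — the two factors trade off exactly. -/
example {κ₁ : ℝ} (hκ : 1 ≤ κ₁) (s : Fin 2 → ℝ) (hs : ∀ j, s j ∈ Icc (0 : ℝ) 1) :
    ‖mixedDeriv (enumS 2 {0, 1}) (fun z : Fin 2 → ℂ => z 0 * z 1) (basePt {0, 1} s)‖ ≤ Real.exp (-((κ₁ - 1) * 2)) * Real.exp (2 * κ₁) := by
  have hF : AnalyticOnNhd ℂ (fun z : Fin 2 → ℂ => z 0 * z 1) univ := (analyticOnNhd_apply 0).mul (analyticOnNhd_apply 1)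
  have hr0 : 0 ≤ Real.exp κ₁ := (Real.exp_pos _).le
  have hB : ∀ p, ‖(fun z : Fin 2 → ℂ => z 0 * z 1) (σS (fun _ => Real.exp κ₁) {0, 1} p)‖ ≤ Real.exp (2 * κ₁) := fun p => by
    dsimp only
    rw [norm_mul, show 2 * κ₁ = κ₁ + κ₁ by ring, Real.exp_add]
    exact mul_le_mul (norm_σS_le (fun _ => hr0) _ p 0) (norm_σS_le (fun _ => hr0) _ p 1) (norm_nonneg _) hr0
  have h := norm_mixedDeriv_enumS_decay_letter hκ {0, 1} hF hB (s := s) (fun j _ => hs j)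
  have hc : (({0, 1} : Finset (Fin 2)).card : ℝ) = 2 := by norm_num
  rwa [hc] at h

/-- THE BRIDGE's PAYOFF (statement-level, BY NAME): Dimock's LEMMA 19 `lemma19_cauchy` applies VERBATIM to the letter's kernel object
`mixedDeriv (enumS S) F (basePt S s)` (through `enumS_nodup`; exponent `(enumS S).length = #S` by `length_enumS`) — the SAME `∂^S F` that §2's
contours represent is the one the template's Cauchy bound controls; nothing of Lemma 19 is re-derived in this file. -/
example {n : ℕ} (S : Finset (Fin n)) {F : (Fin n → ℂ) → ℂ} (hF : AnalyticOnNhd ℂ F univ) {κ₁ A : ℝ} (hκ : 1 ≤ κ₁)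
    (hA : ∀ z ∈ polydisc (fun _ : Fin n => Real.exp κ₁), ‖F z‖ ≤ A) {s : Fin n → ℝ}
    (hs : basePt S s ∈ polydisc (fun _ : Fin n => (1 : ℝ))) :
    ‖mixedDeriv (enumS n S) F (basePt S s)‖ ≤ A * Real.exp (-(κ₁ - 1) * (enumS n S).length) :=
  lemma19_cauchy isOpen_univ hF hκ (subset_univ _) hA (enumS_nodup n S) hs

end Summit.QuantumFields.BalabanUV.T4Continuum.NE1p.DressedSmallFieldMixedDerivativeLetter

end
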